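import Summits.Schanuel.Schanuel.Theorems.ZilberEacExpExpDensityGeneral
import Summits.Schanuel.Schanuel.Theorems.ZilberEacMovingGraphPure
import Summits.Schanuel.Schanuel.Theorems.ZilberEacMovingLineAll
import HarnessLib

/-!
# Mantova–Masser's typed density question on the whole univariate moving-target family: YES

Zilber's Exponential-Algebraic Closedness, case ladder (host summit Schanuel, cell `pub-schanuel`,
seat 2, gen 8).  THE FAMILY: for `p, A, F ∈ ℂ[x]`,

  `W(p; A, F) = {x₁ = p(x₀), y₀ = A(x₀) + y₁ F(y₁)} ⊆ ℂ² × ℂ²`  (`movingGraphSurface p A (F.toMv 0)`),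

whose exponential points are the solutions of `e^{z} = A(z) + e^{p(z)} F(e^{p(z)})`.

THE RESULTS (`W ∩ G² = S` its torus part):

* `mmQuestion_movingTarget` — for EVERY `p`, EVERY non-constant `A` and EVERY `F`:
  `MMCaseDimPiOneFree W → UnprojectedDense W` — Mantova–Masser's question AS TYPED
  (`EACDensityQuestion`: "is `W ∩ Γ_exp` Zariski dense in `W` whenever `dim cl π(S) = 1` and
  `cl π(S)` is not a line of rational slope?") has answer YES on this whole 3-parameter family
  (recall it is NO in general: the resonant parabola `{x₁ = x₀²/(2πi), y₀ = 1}` has CONSTANT `A`);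
* `mmFreeQuestion_movingTarget_of_two_le` — for EVERY `p` of degree `≥ 2` and ALL `A, F`
  (constants included): `MMCaseDimPiOneFree W → IsMulFree(S) → UnprojectedDense W` — the repaired
  (free) question has answer YES.

Case list behind it: `deg p = 0` is never in the case (`x₁ = b` is a rational line); `deg p = 1` is the
line family of `ZilberEacMovingLineAll` (in the case iff the slope is irrational, then dense, every
`F`); `deg p ≥ 2` with `F ≠ 0` is the exp–exp balance (`unprojectedDense_movingGraph_of_two_le`, any
`A`), with `F = 0` the pure target `e^{z} = A(z)` (`unprojectedDense_movingGraph_zero`, `deg A ≥ 1`,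
forced by freeness).  What is NOT covered: lines (`deg p ≤ 1`) with CONSTANT `A` and `F ≠ 0` (e.g.
`e^{z} = 1 + e^{√2 z}`: zeros in a vertical strip, no growth — a Ritt-factorisation question), recorded
as open.

HONEST FRAMING: a complete answer on one explicit polynomial family to an auxiliary question of
Mantova–Masser (2024, §1); modest EAC rungs; `EC(3,2)` OPEN; NOT Schanuel's conjecture; EAC ⇏ SC.
-/

noncomputable section

open Complex MvPolynomial Filter Topology
open Literature.NumberTheory.Transcendental Literature.ModelTheory.Zilber

set_option linter.dupNamespace false

namespace Summit.Schanuel.Schanuel.Theorems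

/-- Degree-one bases are the line family: `W(aX+b; A, F) = movingLineSurface a b A F`. [folklore] -/
theorem movingGraphSurface_linePoly_eq_movingLineSurface (a b : ℂ) (A F : Polynomial ℂ) :
    movingGraphSurface (linePoly a b) A (F.toMvPolynomial 0) = movingLineSurface a b A F := rfl

/-- Degree-zero bases: `W(b; A, F) = movingLineSurface 0 b A F` (the vertical line `x₁ = b`). [folklore] -/
theorem movingGraphSurface_C_eq_movingLineSurface (b : ℂ) (A F : Polynomial ℂ) :
    movingGraphSurface (Polynomial.C b) A (F.toMvPolynomial 0) = movingLineSurface 0 b A F := by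
  have h : linePoly 0 b = Polynomial.C b := by simp [linePoly]
  rw [← movingGraphSurface_linePoly_eq_movingLineSurface, h]

/-- On `W(p; a, 0) = {x₁ = p(x₀), y₀ = a}` (constant `A = a`, `F = 0`) the torus part is not
multiplicatively free unless it is empty: so case ∧ free forces `deg A ≥ 1` when `F = 0`. [folklore] -/
theorem natDegree_pos_of_mmCase_of_isMulFree_zero {p A : Polynomial ℂ}
    (hcase : MMCaseDimPiOneFree (movingGraphSurface p A 0))
    (hfree : IsMulFree ℂ 2 (movingGraphSurface p A 0 ∩ torusLocus ℂ 2)) : 0 < A.natDegree := by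
  by_contra hA
  push Not at hA
  have hA0 : A.natDegree = 0 := by omega
  obtain ⟨z₀, hz₀W, hz₀T⟩ := hcase.2.1
  have hval : ∀ z ∈ movingGraphSurface p A 0 ∩ torusLocus ℂ 2, z (Sum.inr 0) = A.coeff 0 := by
    rintro z ⟨hzW, -⟩
    rw [mem_movingGraphSurface_iff] at hzW
    rw [hzW.2, map_zero, mul_zero, add_zero, Polynomial.eq_C_of_natDegree_eq_zero hA0,
      Polynomial.eval_C, Polynomial.coeff_C_zero]
  refine hfree ![1, 0] (by
    intro h
    have := congrArg (fun f => f 0) h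
    simp at this) ⟨A.coeff 0, fun z hz => ?_⟩
  rw [Fin.prod_univ_two]
  simp only [Matrix.cons_val_zero, Matrix.cons_val_one, zpow_one, zpow_zero,
    mul_one]
  exact hval z hz

/-- **The free typed question over every graph base of degree `≥ 2`: YES** — for ALL `A, F ∈ ℂ[x]`
(constants included): case ∧ multiplicatively free ⟹ dense. (new) [cite: MantovaMasser2023, §1 Further remarks] -/
theorem mmFreeQuestion_movingTarget_of_two_le {p : Polynomial ℂ} (hp : 2 ≤ p.natDegree)
    (A F : Polynomial ℂ) (hcase : MMCaseDimPiOneFree (movingGraphSurface p A (F.toMvPolynomial 0)))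
    (hfree : IsMulFree ℂ 2 (movingGraphSurface p A (F.toMvPolynomial 0) ∩ torusLocus ℂ 2)) :
    UnprojectedDense (movingGraphSurface p A (F.toMvPolynomial 0)) := by
  by_cases hF : F = 0
  · subst hF
    rw [map_zero] at hcase hfree ⊢
    exact unprojectedDense_movingGraph_zero hp (natDegree_pos_of_mmCase_of_isMulFree_zero hcase hfree)
  · exact unprojectedDense_movingGraph_of_two_le hp A hF

/-- Over graph bases of degree `≥ 2` the case alone suffices as soon as `F ≠ 0` or `deg A ≥ 1`
(no freeness needed). (new) [cite: MantovaMasser2023, §1 Further remarks] -/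
theorem unprojectedDense_movingTarget_of_two_le {p : Polynomial ℂ} (hp : 2 ≤ p.natDegree)
    {A F : Polynomial ℂ} (h : F ≠ 0 ∨ 0 < A.natDegree) :
    UnprojectedDense (movingGraphSurface p A (F.toMvPolynomial 0)) := by
  by_cases hF : F = 0
  · subst hF
    rw [map_zero]
    exact unprojectedDense_movingGraph_zero hp (h.resolve_left (fun h => h rfl))
  · exact unprojectedDense_movingGraph_of_two_le hp A hF

/-- **Mantova–Masser's question AS TYPED on the whole univariate moving-target family: YES.**  For
every `p ∈ ℂ[x]`, every NON-CONSTANT `A ∈ ℂ[x]` and every `F ∈ ℂ[x]`: if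
`W = {x₁ = p(x₀), y₀ = A(x₀) + y₁F(y₁)}` is in case (dim-pi-S-1-free) then its exponential points
are Zariski dense in `W`. (new) [cite: MantovaMasser2023, §1 Further remarks] -/
theorem mmQuestion_movingTarget (p : Polynomial ℂ) {A : Polynomial ℂ} (hA : 0 < A.natDegree)
    (F : Polynomial ℂ) (hcase : MMCaseDimPiOneFree (movingGraphSurface p A (F.toMvPolynomial 0))) :
    UnprojectedDense (movingGraphSurface p A (F.toMvPolynomial 0)) := by
  rcases Nat.lt_or_ge p.natDegree 2 with hlt | hge
  · -- degree `≤ 1`: a line `a x₀ + b`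
    have hpeq : p = linePoly (p.coeff 1) (p.coeff 0) :=
      Polynomial.eq_X_add_C_of_natDegree_le_one (by omega)
    rw [hpeq, movingGraphSurface_linePoly_eq_movingLineSurface] at hcase ⊢
    exact unprojectedDense_movingLine_of_mmCase _ hA F hcase
  · exact unprojectedDense_movingTarget_of_two_le hge (Or.inr hA)

/-- … equivalently, with the case hypotheses unfolded: for non-constant `A` the exponential points of
`W(p; A, F)` are dense for EVERY `F` iff (`deg p ≥ 2`) or (`deg p = 1` with irrational slope); for
`deg p = 0` and for rational slopes `W` is not in the case. This packages the degree-`0` exclusion.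
(new) [cite: MantovaMasser2023, §1 Further remarks] -/
theorem not_mmCase_movingTarget_C (b : ℂ) {A : Polynomial ℂ} (hA : 0 < A.natDegree)
    (F : Polynomial ℂ) : ¬ MMCaseDimPiOneFree (movingGraphSurface (Polynomial.C b) A (F.toMvPolynomial 0)) := by
  rw [movingGraphSurface_C_eq_movingLineSurface]
  have h := not_mmCase_movingLineSurface_rat (A := A) 0 b hA F
  rwa [Rat.cast_zero] at h

/-- **Summary over graph bases of degree `≥ 2` with non-constant target**: case ∧ free ∧ dense, for
every `F ∈ ℂ[x]` and no condition on `lc(p)`. (new) [cite: MantovaMasser2023, §1 Further remarks] -/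
theorem unprojectedDensityQuestion_instance_movingTarget {p : Polynomial ℂ} (hp : 2 ≤ p.natDegree)
    {A : Polynomial ℂ} (hA : 0 < A.natDegree) (F : Polynomial ℂ) :
    MMCaseDimPiOneFree (movingGraphSurface p A (F.toMvPolynomial 0)) ∧
      IsMulFree ℂ 2 (movingGraphSurface p A (F.toMvPolynomial 0) ∩ torusLocus ℂ 2) ∧
      UnprojectedDense (movingGraphSurface p A (F.toMvPolynomial 0)) := by
  obtain ⟨h1, h2⟩ := mmCase_movingGraph_of_two_le hp hA (F.toMvPolynomial 0)
  exact ⟨h1, h2, unprojectedDense_movingTarget_of_two_le hp (Or.inr hA)⟩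

/-- **Example**: `e^{z} = z` over the quartic, `{x₁ = x₀⁴, y₀ = x₀}` (pure target, explosion base):
dense. (new) -/
theorem unprojectedDense_quartic_pure :
    UnprojectedDense (movingGraphSurface (Polynomial.X ^ 4) Polynomial.X 0) := by
  have h := unprojectedDense_movingTarget_of_two_le (p := (Polynomial.X ^ 4 : Polynomial ℂ))
    (A := Polynomial.X) (F := 0) (by rw [Polynomial.natDegree_X_pow]; norm_num)
    (Or.inr (by rw [Polynomial.natDegree_X]; exact one_pos))
  rwa [map_zero] at h

end Summit.Schanuel.Schanuel.Theorems

end
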